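import Literature.NumberTheory.DiophantineGeometry.GenEllMechanismField
import Literature.NumberTheory.DiophantineGeometry.GenEllPhiMechanism
import Literature.NumberTheory.DiophantineGeometry.GenEllDeCoverFarFromCuspsMechanism
import Literature.NumberTheory.DiophantineGeometry.GenEllDeCriticalValuesFamily
import Literature.NumberTheory.DiophantineGeometry.SuperellipticHeightsFamilyBelyi
import Literature.NumberTheory.DiophantineGeometry.GenEllPullbackConductor
import HarnessLib

/-!
# [GenEll] Thm 2.1 for `ℙ¹` (W9 assembly, piece 2): the noncritical-Belyi mechanism of the family
# `t_c`, assembled — Vojta on the mechanism set modulo the conductor bound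

S. Mochizuki, *Arithmetic elliptic curves in general position*, Math. J. Okayama Univ. **52** (2010),
Thm. 2.1 (ii) ⇒ (i), proof pp. 12–13 [cite: MochizukiGenEll2010, Thm 2.1 p.12]; the cell's
number-field-only architecture `GENELLTWO-P1ROUTE.md` (abc-iut-S6) §3–§4, owner assignment
«GenEllMechanismAssembly» (STATUS 2026-08-26T02:02:38Z).

A MECHANISM is `(k, c, φ)`: the cover `D_e : r^e = x(1−x)` (`e = 2k+1`), the base function
`t_c = ((1 − 2x) + c·r^{k+2})/(r(1 − 2x))` (`DeCrit.tC`), and a Belyi map `ρ_T = φ = (f : g)` of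
`ℙ¹` of degree `n` (S7's `GenEll.P1FiniteMap` currency, `exists_p1FiniteMap_noncritical_protect`)
with `|ρ_T⁻¹{0,1,∞} ∖ {∞}| = n + 2`.  Its BAD polynomial is d015's resultant
`g := Res_r(curvePoly, G_m)`, `m := f·g·(f−g)` — the `x`-coordinates of `E_φ = t_c⁻¹(ρ_T⁻¹{0,1,∞})`.

For every point `P = (F, x)` the auxiliary points of S6's bookkeeping `vojtaIneq_of_belyi_mechanism`
(p414036) are taken over the field `L_P := F(r)(θ)` of piece 1 (`GenEllMechanismField`):
`Q P := P.mechPoint e μ = (L_P, x)`, `Z P := (Q P).imageAt (ρ_T(t_c(x, r)))` (re-presented over its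
minimal field), `κ P := log-cond_{ρ_T^*C}(t_c(x,r))` over `L_P` (S4's `NFPoint.logCondDiv`).  This file
DISCHARGES, for all `P` of the mechanism set `T` (conjugates `ρ`-far from the roots of `g` at `∞` and
at `2`) with `x ≠ 1/2`:

* `hZmem`, `hZfar` — W7 (w4-d031 `exists_farFromCusps_imageAt_of_far_aroots_resultant`, over d015's
  `De.rootSet_resultant_homFibrePolyC`);
* `hZht` with `A = n(2k+4)/(2k+1)` — W4a-c (S4 g3 `Superelliptic.exists_belyi_tFunC_hZht`);
* `hZcond` — Prop. 1.7 (i) left for `ρ_T` (S4 `NFPoint.logCond_sub_logCondDiv_le`);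
* `hQ` — Prop. 1.7 (i) right for the Kummer cover (d015 `logDiff_dePoint_le`, S6 p412501) plus the
  log-different of the fixed layer `F(r) ⊆ F(r)(θ)` (hypothesis `hD`, a constant depending on `μ`);

and concludes `VojtaIneq T d ε` from the two remaining inputs: the W5 conductor bound
`hκ : κ P ≤ B_c·ht P + C` (`B_c = ((n+2)(2k+4) − (6k+6))/(2k+1)`) and the slope inequalities
(`exists_eps_of_margin`).  The points with `x = 1/2` (where `t_c = ∞`) have bounded height and are
added back (`vojtaIneq_of_half`).  Theorems only; classical, nothing here bears on [IUTchIII] Cor. 3.12.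
-/

noncomputable section

open Polynomial NumberField

namespace Literature.NumberTheory.DiophantineGeometry.GenEll

/-! ## Elementary facts about `t_c` and far points -/
/-- The two forms of `t_c` agree off the poles: `t·(r·s) = s + c·r^{k+2}` for
`t = ((1−2x) + c r^{k+2})/(r(1−2x))`, `s = 1 − 2x`, `r, s ≠ 0`. [folklore] -/
private theorem tC_mul_eq {L : Type*} [Field L] (k : ℕ) (c : L) {x r : L} (hr : r ≠ 0) (hs : 1 - 2 * x ≠ 0) :
    DeCrit.tC k c x r * (r * (1 - 2 * x)) = (1 - 2 * x) + c * r ^ (k + 2) := by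
  unfold DeCrit.tC
  rw [div_mul_cancel₀ _ (mul_ne_zero hr hs)]

/-- **Points with `x = 1/2` satisfy Vojta trivially**: their normalised height is the constant
`h(1/2)`, while `log-diff, log-cond ≥ 0`; so for `1 + ε ≥ 0`, `VojtaIneq {x = 1/2} d ε`.
(The Weierstrass fibre of `D_e`, where `t_c = ∞`, is split off the mechanism.)
[cite: MochizukiGenEll2010, Thm 2.1 proof p.12] -/
theorem vojtaIneq_of_half {d : ℕ} {ε : ℝ} (hε : 0 ≤ 1 + ε) :
    VojtaIneq {P : NFPoint | 1 - 2 * P.x = 0} d ε := by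
  refine ⟨Height.logHeight₁ ((2 : ℚ)⁻¹), fun P hP => ?_⟩
  obtain ⟨hx, -⟩ := hP
  simp only [Set.mem_setOf_eq] at hx
  have hx' : P.x = algebraMap ℚ P.F ((2 : ℚ)⁻¹) := by
    rw [map_inv₀, map_ofNat]
    have h2 : (2 : P.F) * P.x = 1 := by linear_combination -hx
    exact eq_inv_of_mul_eq_one_right h2
  have hht : P.ht = Height.logHeight₁ ((2 : ℚ)⁻¹) := by
    have h := NumberField.logHeight₁_map_ringHom (algebraMap ℚ P.F) ((2 : ℚ)⁻¹)
    rw [Module.finrank_self, Nat.cast_one, one_mul] at h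
    have hP : (0 : ℝ) < P.degree := Nat.cast_pos.mpr P.degree_pos
    unfold NFPoint.ht
    rw [hx']
    change (P.degree : ℝ)⁻¹ * Height.logHeight₁ (algebraMap ℚ P.F 2⁻¹) = _
    change Height.logHeight₁ (algebraMap ℚ P.F 2⁻¹) = (P.degree : ℝ) * _ at h
    rw [h, ← mul_assoc, inv_mul_cancel₀ hP.ne', one_mul]
  simp only
  nlinarith [P.logDiff_nonneg, P.logCond_nonneg]

/-! ## The mechanism on its separation set, modulo the conductor bound -/

section Mechanism

variable (k : ℕ) (c : ℚ) (φ : P1FiniteMap) (μ : ℚ[X])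

/-- **The noncritical-Belyi mechanism `(k, c, ρ_T)` assembled, modulo the W5 conductor bound** — for
points with `x ≠ 1/2`.  Data: `e = 2k+1` (`k ≥ 1`), `c ∈ ℚ^×`, a finite map `ρ_T = (f : g)` of `ℙ¹`
of degree `n > 0` with `deg f = deg g = deg (f − g) = n` and `f, g` coprime (S7's noncritical-Belyi
currency), and a fixed `μ ∈ ℚ[X]` of positive degree (the primitive polynomial of the field of the cusp
fibre).  Let `g_bad := Res_r(curvePoly, G_{f g (f−g)})` and let `T` be a set of points all of whose
conjugates at `∞` and at `2` are `ρ`-far from the roots of `g_bad`, with `x ≠ 1/2`.  Assume, with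
`A := n(2k+4)/(2k+1)` and `B_c := ((n+2)(2k+4) − (6k+6))/(2k+1)`:
(hκ) the conductor of `t_c(x, r)` along `ρ_T^*C`, over `F(r)(θ)`, is `≤ B_c·ht P + C₂` on
`T ∩ U^{≤d}`; (hD) `log-diff(F(r)(θ)) ≤ log-diff(F(r)) + D` on `T ∩ U^{≤d}`; and the slope inequalities
`0 < A − (1+ε')B_c`, `(1+ε')/(A − (1+ε')B_c) ≤ 1+ε`.  Then `VojtaIneq T d ε`.
[cite: MochizukiGenEll2010, Thm 2.1 proof pp.12–13] -/
theorem vojtaIneq_mechanism_of_condBound_of_ne_half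
    (h2 : ABCCompactlyBounded ({2} : Finset ℕ)) (hk : 1 ≤ k) (hc : c ≠ 0)
    (hdeg : 0 < φ.deg) (hnum : φ.num.natDegree = φ.deg) (hden : φ.den.natDegree = φ.deg)
    (hsub : (φ.num - φ.den).natDegree = φ.deg)
    (hcop : IsCoprime (φ.num.map (Int.castRingHom ℚ)) (φ.den.map (Int.castRingHom ℚ)))
    (hμ : μ.natDegree ≠ 0) {d : ℕ} (hd : 0 < d) {ε ε' ρ : ℝ} (hε' : 0 < ε') (hρ : 0 < ρ)
    (T : Set NFPoint)
    (hTℂ : ∀ P ∈ T, ∀ σ : P.F →+* ℂ, ∀ a ∈ (resultant (De.curvePoly k) (De.homFibrePolyC k c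
      (φ.num.map (Int.castRingHom ℚ) * φ.den.map (Int.castRingHom ℚ) *
        (φ.num.map (Int.castRingHom ℚ) - φ.den.map (Int.castRingHom ℚ))))).aroots ℂ,
      ρ < ‖σ P.x - a‖)
    (hT₂ : ∀ P ∈ T, ∀ σ : P.F →+* PadicAlgCl 2, ∀ a ∈ (resultant (De.curvePoly k)
      (De.homFibrePolyC k c
      (φ.num.map (Int.castRingHom ℚ) * φ.den.map (Int.castRingHom ℚ) *
        (φ.num.map (Int.castRingHom ℚ) - φ.den.map (Int.castRingHom ℚ))))).aroots (PadicAlgCl 2),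
      ρ < ‖σ P.x - a‖)
    (hThalf : ∀ P ∈ T, 1 - 2 * P.x ≠ 0)
    {C₂ D : ℝ}
    (hκ : ∀ P ∈ T ∩ UPle d,
      aeval (DeCrit.tC k (algebraMap ℚ (P.mechField (2 * k + 1) μ) c)
          (P.mechPoint (2 * k + 1) μ).x (P.mechRoot (2 * k + 1) μ))
        (φ.num * φ.den * (φ.num - φ.den)) ≠ 0 →
      (⟨P.mechField (2 * k + 1) μ, DeCrit.tC k (algebraMap ℚ (P.mechField (2 * k + 1) μ) c)
          (P.mechPoint (2 * k + 1) μ).x (P.mechRoot (2 * k + 1) μ)⟩ : NFPoint).logCondDiv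
          φ.pullbackCusps ≤
        ((φ.deg + 2 : ℝ) * (2 * k + 4) - (6 * k + 6)) / (2 * k + 1) * P.ht + C₂)
    (hD : ∀ P ∈ T ∩ UPle d,
      (P.mechPoint (2 * k + 1) μ).logDiff ≤ (P.dePoint (2 * k + 1)).logDiff + D)
    (hslope : 0 < (φ.deg : ℝ) * (2 * k + 4) / (2 * k + 1) -
      (1 + ε') * (((φ.deg + 2 : ℝ) * (2 * k + 4) - (6 * k + 6)) / (2 * k + 1)))
    (hε : (1 + ε') / ((φ.deg : ℝ) * (2 * k + 4) / (2 * k + 1) -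
      (1 + ε') * (((φ.deg + 2 : ℝ) * (2 * k + 4) - (6 * k + 6)) / (2 * k + 1))) ≤ 1 + ε) :
    VojtaIneq T d ε := by
  classical
  have he : 0 < 2 * k + 1 := by omega
  -- the rational forms of `f, g` and the bad polynomial
  set pℚ : ℚ[X] := φ.num.map (Int.castRingHom ℚ) with hp
  set qℚ : ℚ[X] := φ.den.map (Int.castRingHom ℚ) with hq
  have hinj : Function.Injective (Int.castRingHom ℚ) := (Int.castRingHom ℚ).injective_int
  have hpn : pℚ.natDegree = φ.deg := by rw [hp, natDegree_map_eq_of_injective hinj, hnum]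
  have hqn : qℚ.natDegree = φ.deg := by rw [hq, natDegree_map_eq_of_injective hinj, hden]
  have hpqn : (pℚ - qℚ).natDegree = φ.deg := by
    rw [hp, hq, ← Polynomial.map_sub, natDegree_map_eq_of_injective hinj, hsub]
  have hp0 : pℚ ≠ 0 := fun h => by rw [h, natDegree_zero] at hpn; omega
  have hq0 : qℚ ≠ 0 := fun h => by rw [h, natDegree_zero] at hqn; omega
  have hne : pℚ ≠ qℚ := fun h => by rw [h, sub_self, natDegree_zero] at hpqn; omega
  -- the degree bound of the auxiliary points
  set N : ℕ := μ.natDegree * ((2 * k + 1) * d) with hN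
  have hNpos : 0 < N := Nat.mul_pos (Nat.pos_of_ne_zero hμ) (Nat.mul_pos he hd)
  -- W7 (w4-d031): the margin `ρ'` at the image points
  obtain ⟨ρ', hρ'0, hρ'2, hfar⟩ := exists_farFromCusps_imageAt_of_far_aroots_resultant k hc hpn hqn
    hpqn hp0 hq0 hne hρ N
  -- W4a-c (S4 g3): the height constant `c₁`
  obtain ⟨c₁, hc₁⟩ := Superelliptic.exists_belyi_tFunC_ht_lower k hk c hc hcop hpn.le hqn.le
    (Or.inl hpn)
  -- the auxiliary points `Q P`, `Z P` and the conductor `κ P`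
  let tP : (P : NFPoint) → P.mechField (2 * k + 1) μ := fun P =>
    DeCrit.tC k (algebraMap ℚ (P.mechField (2 * k + 1) μ) c) (P.mechPoint (2 * k + 1) μ).x
      (P.mechRoot (2 * k + 1) μ)
  let zP : (P : NFPoint) → P.mechField (2 * k + 1) μ := fun P =>
    aeval (tP P) pℚ / aeval (tP P) qℚ
  let Q : NFPoint → NFPoint := fun P => P.mechPoint (2 * k + 1) μ
  let Z : NFPoint → NFPoint := fun P => (P.mechPoint (2 * k + 1) μ).imageAt (zP P)
  let κ : NFPoint → ℝ := fun P =>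
    (⟨P.mechField (2 * k + 1) μ, tP P⟩ : NFPoint).logCondDiv φ.pullbackCusps
  -- integer forms evaluate as their rational images
  have haeZ : ∀ (P : NFPoint) (F : ℤ[X]) (y : P.mechField (2 * k + 1) μ),
      aeval y (F.map (Int.castRingHom ℚ)) = aeval y F := fun P F y => by
    rw [← algebraMap_int_eq, aeval_map_algebraMap]
  -- PER-POINT FACTS on `T ∩ U^{≤d}`
  have facts : ∀ P ∈ T ∩ UPle d,
      P.InU ∧ P.mechRoot (2 * k + 1) μ ≠ 0 ∧ 1 - 2 * (P.mechPoint (2 * k + 1) μ).x ≠ 0 ∧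
      (tP P * (P.mechRoot (2 * k + 1) μ * (1 - 2 * (P.mechPoint (2 * k + 1) μ).x)) =
        (1 - 2 * (P.mechPoint (2 * k + 1) μ).x) +
          algebraMap ℚ (P.mechField (2 * k + 1) μ) c * P.mechRoot (2 * k + 1) μ ^ (k + 2)) ∧
      ((Z P).FarFromCusps ({2} : Finset ℕ) ρ' ∧ Z P ∈ UPle N) := by
    intro P hP
    have hPU : P.InU := hP.2.1.1
    have hr : P.mechRoot (2 * k + 1) μ ≠ 0 := P.mechRoot_ne_zero (2 * k + 1) μ hPU he
    have hs : 1 - 2 * (P.mechPoint (2 * k + 1) μ).x ≠ 0 :=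
      (P.one_sub_two_mul_mechPoint_x_ne_zero_iff (2 * k + 1) μ).mpr (hThalf P hP.1)
    have hcurve : P.mechRoot (2 * k + 1) μ ^ (2 * k + 1) =
        algebraMap P.F (P.mechField (2 * k + 1) μ) P.x *
          (1 - algebraMap P.F (P.mechField (2 * k + 1) μ) P.x) := P.mechRoot_pow (2 * k + 1) μ he
    exact ⟨hPU, hr, hs, tC_mul_eq k _ hr hs, hfar P (hTℂ P hP.1) (hT₂ P hP.1)
      (P.mechPoint (2 * k + 1) μ) (algebraMap P.F (P.mechField (2 * k + 1) μ))
      (P.mechRoot (2 * k + 1) μ) (P.degree_mechPoint_le_of_le (2 * k + 1) μ he hμ hP.2.2 le_rfl)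
      hcurve hr hs⟩
  -- the bookkeeping theorem
  refine vojtaIneq_of_belyi_mechanism h2 (S := T) (d := d) (d' := N) hNpos hε' hρ'0 hρ'2 Z Q κ
    (A := (φ.deg : ℝ) * (2 * k + 4) / (2 * k + 1))
    (Bc := ((φ.deg + 2 : ℝ) * (2 * k + 4) - (6 * k + 6)) / (2 * k + 1))
    (c₁ := c₁ / (2 * k + 1)) (c₂ := C₂)
    (c₃ := 2 * Real.log (((2 * k + 1) * ((2 * k + 1) * (2 * k + 1).factorial) : ℕ) : ℝ) + D)
    ?_ ?_ ?_ ?_ ?_ ?_ hslope hε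
  · -- hZmem : `Z P ∈ U^{≤N}`
    intro P hP
    exact (facts P hP).2.2.2.2.2
  · -- hZfar : W7
    intro P hP
    exact (facts P hP).2.2.2.2.1
  · -- hZht : W4a-c through the `ℙ¹` machine for `ρ_T`
    intro P hP
    obtain ⟨hPU, hr, hs, ht, -⟩ := facts P hP
    have hxU : (P.mechPoint (2 * k + 1) μ).InU := (P.inU_mechPoint_iff (2 * k + 1) μ).mpr hPU
    have ht' : tP P * (P.mechRoot (2 * k + 1) μ * (1 - 2 * (P.mechPoint (2 * k + 1) μ).x)) =
        (1 - 2 * (P.mechPoint (2 * k + 1) μ).x) +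
          (c : (P.mechPoint (2 * k + 1) μ).F) * P.mechRoot (2 * k + 1) μ ^ (k + 2) := by
      rw [ht, ← eq_ratCast (algebraMap ℚ (P.mechField (2 * k + 1) μ)) c]
    have h := hc₁ (P.mechField (2 * k + 1) μ) (P.mechPoint (2 * k + 1) μ).x
      (P.mechRoot (2 * k + 1) μ) (1 - 2 * (P.mechPoint (2 * k + 1) μ).x) (tP P) rfl
      (P.mechRoot_pow (2 * k + 1) μ he) hxU.1 hxU.2 hs ht'
    have e1 : (NFPoint.mk (P.mechField (2 * k + 1) μ) (P.mechPoint (2 * k + 1) μ).x).ht = P.ht :=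
      P.ht_mechPoint (2 * k + 1) μ
    have e2 : (Z P).ht = (NFPoint.mk (P.mechField (2 * k + 1) μ) (zP P)).ht :=
      (P.mechPoint (2 * k + 1) μ).ht_imageAt (zP P)
    rw [e1, ← e2] at h
    exact h
  · -- hZcond : Prop. 1.7 (i) left for `ρ_T` along `ℚ(z) ⊆ F(r)(θ)`
    intro P hP
    obtain ⟨-, -, -, -, hfarP, -⟩ := facts P hP
    have hzU : zP P ≠ 0 ∧ zP P ≠ 1 :=
      ((P.mechPoint (2 * k + 1) μ).imageAt_inU_iff (zP P)).mp (hfarP.inU hρ'0.le)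
    -- `g(t) ≠ 0` since `z = f(t)/g(t) ≠ 0`
    have hqt : aeval (tP P) qℚ ≠ 0 := by
      intro h0
      apply hzU.1
      change aeval (tP P) pℚ / aeval (tP P) qℚ = 0
      rw [h0, div_zero]
    have hmaps : NFPoint.MapsUnder φ (Z P) ⟨P.mechField (2 * k + 1) μ, tP P⟩
        (NFPoint.imageEmb ⟨P.mechField (2 * k + 1) μ, tP P⟩ (zP P)) := by
      refine ⟨?_, ?_⟩
      · change aeval (tP P) φ.den ≠ 0
        rwa [← haeZ P φ.den]
      · change aeval (tP P) φ.num =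
          NFPoint.imageEmb ⟨P.mechField (2 * k + 1) μ, tP P⟩ (zP P)
            ((NFPoint.imageAt ⟨P.mechField (2 * k + 1) μ, tP P⟩ (zP P)).x) * aeval (tP P) φ.den
        rw [NFPoint.imageEmb_x, ← haeZ P φ.num, ← haeZ P φ.den]
        change aeval (tP P) pℚ = aeval (tP P) pℚ / aeval (tP P) qℚ * aeval (tP P) qℚ
        rw [div_mul_cancel₀ _ hqt]
    have h := NFPoint.logCond_sub_logCondDiv_le hmaps (hfarP.inU hρ'0.le)
    have hQt : (⟨P.mechField (2 * k + 1) μ, tP P⟩ : NFPoint).logDiff =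
        (P.mechPoint (2 * k + 1) μ).logDiff := rfl
    change (Z P).logDiff + (Z P).logCond ≤ (P.mechPoint (2 * k + 1) μ).logDiff + κ P
    rw [← hQt]
    linarith
  · -- hκ : the W5 conductor bound, at points off the cusp fibre (`f(t)·g(t)·(f−g)(t) ≠ 0`)
    intro P hP
    obtain ⟨-, -, -, -, hfarP, -⟩ := facts P hP
    have hzU : zP P ≠ 0 ∧ zP P ≠ 1 :=
      ((P.mechPoint (2 * k + 1) μ).imageAt_inU_iff (zP P)).mp (hfarP.inU hρ'0.le)
    have hpq : aeval (tP P) pℚ ≠ 0 ∧ aeval (tP P) qℚ ≠ 0 := div_ne_zero_iff.mp hzU.1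
    have hpq1 : aeval (tP P) pℚ ≠ aeval (tP P) qℚ := by
      intro h
      apply hzU.2
      change aeval (tP P) pℚ / aeval (tP P) qℚ = 1
      rw [h, div_self hpq.2]
    refine hκ P hP ?_
    rw [map_mul, map_mul, map_sub, ← haeZ P φ.num, ← haeZ P φ.den]
    exact mul_ne_zero (mul_ne_zero hpq.1 hpq.2) (sub_ne_zero.mpr hpq1)
  · -- hQ : Prop. 1.7 (i) right for the Kummer cover, plus the fixed layer `F(r) ⊆ F(r)(θ)`
    intro P hP
    obtain ⟨hPU, -⟩ := facts P hP
    have h1 := hD P hP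
    have h2 := P.logDiff_dePoint_le (2 * k + 1) hPU he
    change (P.mechPoint (2 * k + 1) μ).logDiff ≤ _
    linarith

/-- **The mechanism assembled, modulo the W5 conductor bound** (all points of the separation set:
the Weierstrass fibre `x = 1/2` is added back by `vojtaIneq_of_half`).  Same data and hypotheses as
`vojtaIneq_mechanism_of_condBound_of_ne_half`, the conductor bound and the fixed-layer different
bound being required only at the points with `x ≠ 1/2`. [cite: MochizukiGenEll2010, Thm 2.1 proof pp.12–13] -/
theorem vojtaIneq_mechanism_of_condBound
    (h2 : ABCCompactlyBounded ({2} : Finset ℕ)) (hk : 1 ≤ k) (hc : c ≠ 0)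
    (hdeg : 0 < φ.deg) (hnum : φ.num.natDegree = φ.deg) (hden : φ.den.natDegree = φ.deg)
    (hsub : (φ.num - φ.den).natDegree = φ.deg)
    (hcop : IsCoprime (φ.num.map (Int.castRingHom ℚ)) (φ.den.map (Int.castRingHom ℚ)))
    (hμ : μ.natDegree ≠ 0) {d : ℕ} (hd : 0 < d) {ε ε' ρ : ℝ} (hε' : 0 < ε') (hρ : 0 < ρ)
    (T : Set NFPoint)
    (hTℂ : ∀ P ∈ T, ∀ σ : P.F →+* ℂ, ∀ a ∈ (resultant (De.curvePoly k) (De.homFibrePolyC k c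
      (φ.num.map (Int.castRingHom ℚ) * φ.den.map (Int.castRingHom ℚ) *
        (φ.num.map (Int.castRingHom ℚ) - φ.den.map (Int.castRingHom ℚ))))).aroots ℂ,
      ρ < ‖σ P.x - a‖)
    (hT₂ : ∀ P ∈ T, ∀ σ : P.F →+* PadicAlgCl 2, ∀ a ∈ (resultant (De.curvePoly k)
      (De.homFibrePolyC k c
      (φ.num.map (Int.castRingHom ℚ) * φ.den.map (Int.castRingHom ℚ) *
        (φ.num.map (Int.castRingHom ℚ) - φ.den.map (Int.castRingHom ℚ))))).aroots (PadicAlgCl 2),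
      ρ < ‖σ P.x - a‖)
    {C₂ D : ℝ}
    (hκ : ∀ P ∈ T ∩ UPle d, 1 - 2 * P.x ≠ 0 →
      aeval (DeCrit.tC k (algebraMap ℚ (P.mechField (2 * k + 1) μ) c)
          (P.mechPoint (2 * k + 1) μ).x (P.mechRoot (2 * k + 1) μ))
        (φ.num * φ.den * (φ.num - φ.den)) ≠ 0 →
      (⟨P.mechField (2 * k + 1) μ, DeCrit.tC k (algebraMap ℚ (P.mechField (2 * k + 1) μ) c)
          (P.mechPoint (2 * k + 1) μ).x (P.mechRoot (2 * k + 1) μ)⟩ : NFPoint).logCondDiv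
          φ.pullbackCusps ≤
        ((φ.deg + 2 : ℝ) * (2 * k + 4) - (6 * k + 6)) / (2 * k + 1) * P.ht + C₂)
    (hD : ∀ P ∈ T ∩ UPle d, 1 - 2 * P.x ≠ 0 →
      (P.mechPoint (2 * k + 1) μ).logDiff ≤ (P.dePoint (2 * k + 1)).logDiff + D)
    (hslope : 0 < (φ.deg : ℝ) * (2 * k + 4) / (2 * k + 1) -
      (1 + ε') * (((φ.deg + 2 : ℝ) * (2 * k + 4) - (6 * k + 6)) / (2 * k + 1)))
    (hε : (1 + ε') / ((φ.deg : ℝ) * (2 * k + 4) / (2 * k + 1) -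
      (1 + ε') * (((φ.deg + 2 : ℝ) * (2 * k + 4) - (6 * k + 6)) / (2 * k + 1))) ≤ 1 + ε) :
    VojtaIneq T d ε := by
  -- the points with `x ≠ 1/2`
  have hmain := vojtaIneq_mechanism_of_condBound_of_ne_half k c φ μ h2 hk hc hdeg hnum hden hsub
    hcop hμ hd hε' hρ (T ∩ {P : NFPoint | 1 - 2 * P.x ≠ 0})
    (fun P hP => hTℂ P hP.1) (fun P hP => hT₂ P hP.1) (fun P hP => hP.2)
    (C₂ := C₂) (D := D)
    (fun P hP => hκ P ⟨hP.1.1, hP.2⟩ hP.1.2) (fun P hP => hD P ⟨hP.1.1, hP.2⟩ hP.1.2) hslope hε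
  -- the points with `x = 1/2`
  have hεpos : 0 ≤ 1 + ε := by
    have h1 : 0 < 1 + ε' := by linarith
    have h2 := div_pos h1 hslope
    linarith
  have hhalf := vojtaIneq_of_half (d := d) hεpos
  -- union
  have hunion : VojtaIneq ((T ∩ {P : NFPoint | 1 - 2 * P.x ≠ 0}) ∪ {P : NFPoint | 1 - 2 * P.x = 0})
      d ε := by
    unfold VojtaIneq at hmain hhalf ⊢
    rw [Set.union_inter_distrib_right]
    exact bdLe_union_iff.mpr ⟨hmain, hhalf⟩
  refine hunion.mono (Set.inter_subset_inter_left _ fun P hP => ?_)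
  by_cases h : 1 - 2 * P.x = 0
  · exact Or.inr h
  · exact Or.inl ⟨hP, h⟩

end Mechanism

end Literature.NumberTheory.DiophantineGeometry.GenEll

end
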